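/-
Copyright (c) 2026 the pub-hodgecm-mathlib formalisation cell (harness21).  Prover seats hodgecm-mathlib-LH4-p09 (g10) (statement, design, ★ prelims; VALVE hand) and
hodgecm-mathlib-K2Liu-p14 (g5) (proof; K1b∕ρ desk, DESK WORD #9 (2) fallback pen after LH4-p09's handoff 2026-09-05T01:29Z), Track B «K2-LIT» ∕ hLiu418 socket #41 KIND 1,
package (K1b-♮), letter (P-dec): THE ONE-FRAME ASSEMBLY — the (P-dec) head's letter `hdecF₀` (★ `K2LiuKindOneLineDecay.wdec_of_oneFrame`, LH4-p14 (g8)) from ONE block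
letter on `h`, all (dec-3) faces discharged by name.  THEOREMS ONLY.
-/
import Summits.HodgeConjecture.HodgeConjecture.Theorems.K2LiuKindOneLineFrameChange            -- ★ p863849: the socket ∕ frame vocabulary of the (P-dec) head
import Summits.HodgeConjecture.HodgeConjecture.Theorems.K2LiuKindOneLineCornerBlockFaces        -- ★ (dec-3c): corner row algebra, `norm_det_rpow_le`, `blockData_of_decomp` (+ ★ (dec-3b-ii), ★ G7)
import Summits.HodgeConjecture.HodgeConjecture.Theorems.K2LiuKindOneLineDecayOneFramePrelims    -- ★ p864121: `perPlace_le` (the per-place factor against ONE ceiling), `one_add_rpow_mul_exp_neg_pi_le`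
import Summits.HodgeConjecture.HodgeConjecture.Theorems.K2LiuKindOneLineCornerGramBoundAdelic    -- ★ p863568 (ρ4-𝔸): `exists_exp_neg_sum_le_exp_neg_height` (+ ★ p862643 rational letters)
import Summits.HodgeConjecture.HodgeConjecture.Theorems.K2LiuSiegelEisensteinKindWBlockAtPoint   -- ★ p862843: `exists_blockDecomposition_archAt`
import Summits.HodgeConjecture.HodgeConjecture.Theorems.K2LiuSiegelEisensteinKindWLocalExponents -- ★ `one_add_pow_mul_exp_neg_le` (absorption of `(1+τ)`-powers into the Gaussian)
import Summits.HodgeConjecture.HodgeConjecture.Theorems.K2LiuSiegelEisensteinKindWDecay          -- ★ `inv_apply_det_le`, `apply_entry_le_norm` (the product-formula floor)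
import HarnessLib

/-!
# Crux `HLiu418`, socket #41, KIND 1 — (P-dec) THE ONE-FRAME ASSEMBLY `K2LiuKindOneLineDecayOneFrame`: `hdecF₀` FROM ONE BLOCK LETTER ON `h`

Cell `hodgecm-mathlib`, crux item hLiu418 = `stmt-HodgeConjecture-24832` (helper lane `--supports … --as helper`, count-neutral), route of record `HCCMUnconditional`;
squad K2 ∕ K2Liu; K1b desk K2Liu-p14 (g5) DESK WORD #9 (2) (2026-09-05T01:08:56Z; statement + design LH4-p09 (g10), proof K2Liu-p14 (g5)), (P-dec) writer LH4-p14 (g8) second reader.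
THEOREMS ONLY (no `def`, no `instance`, no notation, no named-fact hypothesis, no `sorry`).

THE POINT.  ★ `K2LiuKindOneLineDecay.wdec_of_oneFrame` (LH4-p14 (g8)) turns ★ p863630's ∀-frame `D`-polynomial decay letters `hWdec1 ∧ hWdec0` into ONE letter `hdecF₀`:
the decay of the line Whittaker coefficient `W(F₀;S′)(s,h)` of the pulled-back family at the translate `Λ₀(γ₀[w])·h`, in ONE frame `F₀`, in the TOP's shape
`C·‖h‖^a·D^{a₂}·(e^{−c‖h‖^{−a′}τS}·(1+τS)^{Nb})`.  THIS FILE proves `∃ Nb, hdecF₀` from ONE by-value BLOCK LETTER `hBL₁` — the (dec-2) FINE LETTER of the (K1b-W) organ in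
BLOCK CURRENCY ON `h` (the organ's EXPORT RULING: the Gaussian must see `‖h‖`, never `‖Λ(ĝ)·h‖`): for every block decomposition `T_σ·(h_∞)~_{w σ}·T_σ⁻¹ = [A_σ, b_σ; 0, d_σ]·κ_σ`
of `h` in the frames of record (★ G7, `p := Fin 2`), with `Y_σ := ĝ^{φ_σ}·A_σ` (the corner block of the TRANSLATE, ★ (dec-3c) `blockDecomp_mul_of_diag`) and
`ρ_σ := Σ_k ‖(Y_σ)_{1k}‖²` (the square of the LINE's Levi coordinate `a₀₀`; `‖det Y_σ‖∕ρ_σ^{1∕2}` the off-corner one), and the rational letters `(D₀, σ♭)` of ★ p862643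
(`c(ĝ)ᵀ·T_L·D₀ = T_L`, `D₀·S·ĝ⁻¹ = σ♭E₁₁`):
  `‖W(F₀;S′)(s,h)‖ ≤ C·‖h‖^a·D^{a₂}·(1+τS)^{N₀} · ∏_σ ρ_σ^{e₁(s)} · ‖det Y_σ‖^{e₂(s)} · (1 + |σ♭|_σ ρ_σ)^{Ng} · e^{−π |σ♭|_σ ρ_σ}`
with payer-chosen exponent functions `e₁, e₂` bounded on the ball ((e∞) ★ p863005: `e₁(s) = −(2 re s + 1)`, `e₂(s) = 2 re s + 2`).  THE CONVERSIONS (all ★, BY NAME):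
the Gaussian by ★ (ρ4-𝔸) p863568 ED. 2 `exists_exp_neg_sum_le_exp_neg_height_of_cover` (letter with EQUALITY at `a² := ρ_σ`, ★ (dec-3c) `corner_row_sq_eq`; movers `M := c_B·‖h‖`
★ G7-B; rational letters ★ p862643); the per-place factor, exponents of EITHER sign, by ★ p864121 `perPlace_le` against the ONE ceiling `8·Vb²·(c_B‖h‖)²` with the entry
bound `Vb = 1 + τS·D^{d+1}(1+τS)^d` (§0: `hnorm`'s entry letters + the PRODUCT-FORMULA floor ★ `KindWDecay.inv_apply_det_le` at `n := 1`), exponents rounded up to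
integers; all `(1 + τS)`-powers absorbed per `z` into `‖h‖^a · e^{−(c∕4)‖h‖^{−2}τS}` (★ `one_add_pow_mul_exp_neg_le`), so `Nb := 0` and `a′ = 2`.
HONEST LABEL.  Count-neutral helper, hypothesis-first in `hBL₁` (payers: the (K1b-W) per-place roads — (e∞) ★ p863005 + ★ (KW1-d) p862696∕p862865 at `∞`, the finite letters,
★ (dec-1) p863428); closes no socket: `HC_CM` is proved only modulo the 7 printed citations (2 remaining named inputs: hLiu418 = `stmt-HodgeConjecture-24832`, h413 =
`stmt-HodgeConjecture-24833`) until rung 0 closes.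
-/

set_option autoImplicit false
set_option linter.dupNamespace false -- the mandated namespace repeats `HodgeConjecture.HodgeConjecture`

noncomputable section

open scoped Matrix ENNReal NNReal ComplexConjugate BigOperators
-- `Classical` is needed to see the Mathlib normed-ring instances on `mixedSpace L` (as in the TOP's `hτ`)
open scoped Classical
open NumberField NumberField.InfinitePlace IsDedekindDomain MeasureTheory MeasureTheory.Measure
open Literature.NumberTheory.Automorphic Literature.NumberTheory.Automorphic.UnitaryGroup Literature.NumberTheory.GaloisRepresentations
open Literature.NumberTheory.GelbartRogawski1991 Literature.NumberTheory.GelbartRogawski1991.GRConstruction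
open Literature.NumberTheory.GelbartRogawski1991.AdaptedBlocks
open Literature.NumberTheory.K2Lit.SiegelDoubled Literature.MeasureTheory.Group
open UnitaryDualPair

namespace Summit.HodgeConjecture.HodgeConjecture.Cruxes.HLiu418.K2LiuKindOneLineDecayOneFrame

open K2LiuSiegelUnipotentFourierDefs K2LiuSiegelUnipotentCharacters K2LiuUnipotentCoveringWeight K2LiuSiegelFourierCoeffDelta
open K2LiuSiegelRationalLeviDecomposition K2LiuSiegelMiddleCellSortedPattern K2LiuSiegelMiddleCellLeviCriterion K2LiuSiegelBruhatMiddleCellDelta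
open K2LiuRankOneCornerIndexTransport (exists_rat_levi_blocks_levi_map conj_index_eq_single)
open K2LiuKindOneLineCornerGramBoundAdelic (exists_exp_neg_sum_le_exp_neg_height)
open K2LiuKindOneLineCornerBlockFaces (corner_row_sq_eq norm_det_rpow_le blockData_of_decomp)
open K2LiuKindOneLineDecayLowerPowerFace (rpow_le_rpow_abs rpow_le_rpow_of_abs_le one_le_of_le_of_inv_le inv_sum_sq_vecMul_le sum_sq_vecMul_pos norm_map_row_apply_eq_one)
open K2LiuSiegelEisensteinKindWBlockAtPoint (exists_blockDecomposition_archAt)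
open K2LiuSiegelEisensteinKindWLocalExponents (one_add_pow_mul_exp_neg_le)
open K2LiuSiegelEisensteinKindWDecay (inv_apply_det_le apply_entry_le_norm)
open K2LiuIwasawaHeightLatticeSumBound (exists_adelicHeightGL_floor)

/-! ## §0 Entry bounds for the normalised row section (the `Vb` of ★ `perPlace_le`) -/

/-- **THE ROW RATIOS OF A RANK-ONE INDEX ARE `τ·D^{d+1}(1+τ)^d`-BOUNDED AT EVERY INFINITE PLACE.**  `S = u ⊗ w` with `u j ≠ 0`, `w i ≠ 0`, `D·S` integral (`1 ≤ D`):
`w_k ∕ w_i = S_{jk} ∕ S_{ji}`, `|S_{jk}|_v ≤ τ` (★ `apply_entry_le_norm`) and `|S_{ji}|_v⁻¹ ≤ D^{d+1}(1+τ)^d` (the product-formula floor ★ `inv_apply_det_le` on the `1×1` matrix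
`(S_{ji})`).  [cite: NeukirchANT1999, Ch. III §1] [cite: Shimura1997, §18.4 Prop. 18.14] -/
theorem norm_embedding_ratio_le {L : Type} [Field L] [NumberField L] (v : InfinitePlace L)
    {S : Matrix (Fin 2) (Fin 2) L} {u w : Fin 2 → L} (hS1 : S = Matrix.vecMulVec u w) {j i : Fin 2} (huj : u j ≠ 0) (hwi : w i ≠ 0)
    {D : ℕ} (hD : 1 ≤ D) (hint : ∀ a b, IsIntegral ℤ ((D : L) * S a b)) (k : Fin 2) :
    ‖v.embedding ((w i)⁻¹ * w k)‖ ≤ ‖fun a b => NumberField.mixedEmbedding L (S a b)‖ *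
      ((D : ℝ) ^ (Module.finrank ℚ L + 1) * (1 + ‖fun a b => NumberField.mixedEmbedding L (S a b)‖) ^ Module.finrank ℚ L) := by
  have hSji : S j i = u j * w i := by rw [hS1]; rfl
  have hSjk : S j k = u j * w k := by rw [hS1]; rfl
  have hSji0 : S j i ≠ 0 := by rw [hSji]; exact mul_ne_zero huj hwi
  have hratio : (w i)⁻¹ * w k = S j k / S j i := by
    rw [hSji, hSjk]; field_simp
  have hτ0 : 0 ≤ ‖fun a b => NumberField.mixedEmbedding L (S a b)‖ := norm_nonneg _
  have hnum : ‖v.embedding (S j k)‖ ≤ ‖fun a b => NumberField.mixedEmbedding L (S a b)‖ := by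
    rw [norm_embedding_eq]; exact apply_entry_le_norm L v S j k
  have hτ1 : ‖fun a b : Fin 1 => NumberField.mixedEmbedding L ((Matrix.of fun _ _ : Fin 1 => S j i) a b)‖ ≤
      ‖fun a b => NumberField.mixedEmbedding L (S a b)‖ := by
    refine (pi_norm_le_iff_of_nonneg hτ0).2 fun a => (pi_norm_le_iff_of_nonneg hτ0).2 fun b => ?_
    simp only [Matrix.of_apply]
    exact (norm_le_pi_norm (fun b => NumberField.mixedEmbedding L (S j b)) i).trans
      (norm_le_pi_norm (fun a b => NumberField.mixedEmbedding L (S a b)) j)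
  have hden := inv_apply_det_le L (Matrix.of fun _ _ : Fin 1 => S j i) (by rw [Matrix.det_fin_one]; exact hSji0) hD
    (fun _ _ => hint j i) hτ1 v
  rw [Matrix.det_fin_one, Matrix.of_apply, ← norm_embedding_eq] at hden
  have hden' : ‖v.embedding (S j i)‖⁻¹ ≤
      (D : ℝ) ^ (Module.finrank ℚ L + 1) * (1 + ‖fun a b => NumberField.mixedEmbedding L (S a b)‖) ^ Module.finrank ℚ L := by
    simpa only [one_mul, Nat.factorial_one, Nat.cast_one, pow_one] using hden
  calc ‖v.embedding ((w i)⁻¹ * w k)‖ = ‖v.embedding (S j k)‖ * ‖v.embedding (S j i)‖⁻¹ := by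
        rw [hratio, map_div₀, norm_div, div_eq_mul_inv]
    _ ≤ _ := mul_le_mul hnum hden' (inv_nonneg.2 (norm_nonneg _)) hτ0

/-- an entry that is `0`, `1` or `±r` with `|r|_v ≤ B` has `|·|_v ≤ 1 + B`. [folklore] -/
theorem norm_embedding_le_one_add_of_cases {L : Type} [Field L] [NumberField L] (v : InfinitePlace L) {x r : L} {B : ℝ} (hB : 0 ≤ B)
    (hr : ‖v.embedding r‖ ≤ B) (hx : x = 0 ∨ x = 1 ∨ x = r ∨ x = -r) : ‖v.embedding x‖ ≤ 1 + B := by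
  rcases hx with rfl | rfl | rfl | rfl
  · rw [map_zero, norm_zero]; linarith
  · rw [map_one, norm_one]; linarith
  · linarith
  · rw [map_neg, norm_neg]; linarith

/-- `1 + τ·(D^{d+1}(1+τ)^d) ≤ D^{d+1}·(1+τ)^{d+1}` for `D ≥ 1`, `τ ≥ 0` (the entry bound `Vb` against the TOP's currencies). [folklore] -/
theorem one_add_mul_le_pow_mul_pow {D τ : ℝ} (hD : 1 ≤ D) (hτ : 0 ≤ τ) (d : ℕ) :
    1 + τ * (D ^ (d + 1) * (1 + τ) ^ d) ≤ D ^ (d + 1) * (1 + τ) ^ (d + 1) := by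
  have hB : 1 ≤ D ^ (d + 1) * (1 + τ) ^ d := one_le_mul_of_one_le_of_one_le (one_le_pow₀ hD) (one_le_pow₀ (by linarith))
  have h : D ^ (d + 1) * (1 + τ) ^ (d + 1) = D ^ (d + 1) * (1 + τ) ^ d + τ * (D ^ (d + 1) * (1 + τ) ^ d) := by ring
  rw [h]
  linarith

/-! ## §1 The one-frame assembly -/

/-- **THE ONE-FRAME ASSEMBLY.**  Socket letters `(L, e, dV, dW)` with `dV, dW ≠ 0`; a section family `f` (by value); ONE `B`-line frame `F₀ = (eA₀ eB₀ dA₀ dB₀ hVA₀ hVB₀, Λ₀ hΛ₀, μ₀, nB₀)`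
BY VALUE (★ `wdec_of_oneFrame`'s bytes); the NORMALISED row section `γ₀` with `hγ₀` and ★ p863259's normalisation clause `hnorm` BY VALUE; the archimedean frames of record BY VALUE
(`Sinf`, complex places `wp σ` fixed by complex conjugation and covering all infinite places, read through `(wp σ).1.embedding`; `er`, `T Tinv`, `M`); and the BLOCK LETTER `hBL₁` (module
docstring).  THEN `∃ Nb, hdecF₀` — the (P-dec) head's letter VERBATIM (`Nb := 0`). [cite: MoeglinWaldspurger1995, II.1.5, II.1.7, IV.1.9] [cite: BorelJacquet1979, §1.2, §4.1]
[cite: KudlaRallis1994, §2 (2.10)–(2.12)] [cite: Shimura1997, §18.4 Prop. 18.14, §A3] -/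
theorem hdecF₀_of_blockLetter
    (L : Type) [Field L] [NumberField L] [IsCMField L] (e : Fin 2 × Fin 1 ≃ Fin 2)
    (dV : Fin 2 → L) (hdV : ∀ i, IsCMField.complexConj L (dV i) = dV i) (hdV0 : ∀ i, dV i ≠ 0)
    (dW : Fin 1 → L) (hdW : ∀ i, IsCMField.complexConj L (dW i) = dW i) (hdW0 : ∀ i, dW i ≠ 0)
    (f : ℂ → HA L e dV hdV dW hdW → ℂ)
    -- ONE `B`-line frame `F₀` BY VALUE (★ `wdec_of_oneFrame`'s bytes)
    {n₁₀ n₂₀ : ℕ} (eA₀ : Fin 1 × Fin 1 ≃ Fin n₁₀) (eB₀ : Fin 1 × Fin 1 ≃ Fin n₂₀)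
    (dA₀ : Fin 1 → L) (hdA₀ : ∀ i, IsCMField.complexConj L (dA₀ i) = dA₀ i)
    (dB₀ : Fin 1 → L) (hdB₀ : ∀ i, IsCMField.complexConj L (dB₀ i) = dB₀ i)
    (hVA₀ : ∀ i, dV (Fin.castAdd 1 i) = dA₀ i) (hVB₀ : ∀ j, dV (Fin.natAdd 1 j) = dB₀ j)
    [MeasurableSpace (unipDelta L eB₀ dB₀ hdB₀ dW hdW)]
    (Λ₀ : GL (Fin 2) (AdeleRing (𝓞 L) L) →* HA L e dV hdV dW hdW)
    (hΛ₀ : ∀ g : GL (Fin 2) (AdeleRing (𝓞 L) L), blk L e dV hdV dW hdW (Λ₀ g) =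
      cayR (AdeleRing (𝓞 L) L) (Fin 2) * Matrix.fromBlocks (g : Matrix (Fin 2) (Fin 2) (AdeleRing (𝓞 L) L)) 0 0
        (((gramR L e dV hdV dW hdW).map ((algebraMap L (AdeleRing (𝓞 L) L)).comp (algebraMap (Fp L) L)))⁻¹ *
          (((g⁻¹ : GL (Fin 2) (AdeleRing (𝓞 L) L)) : Matrix (Fin 2) (Fin 2) (AdeleRing (𝓞 L) L)).map
            (conjAdele (Fp L) L (IsCMField.complexConj L)))ᵀ *
          (gramR L e dV hdV dW hdW).map ((algebraMap L (AdeleRing (𝓞 L) L)).comp (algebraMap (Fp L) L))) *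
        cayRinv (AdeleRing (𝓞 L) L) (Fin 2))
    [MeasurableSpace (AdeleRing (𝓞 (Fp L)) (Fp L))]
    (μ₀ : Measure (AdeleRing (𝓞 (Fp L)) (Fp L)))
    (nB₀ : AdeleRing (𝓞 (Fp L)) (Fp L) → unipDelta L eB₀ dB₀ hdB₀ dW hdW)
    -- the NORMALISED row section BY VALUE (★ p863259 `exists_normalised_rowSection`'s clauses)
    (γ₀ : Projectivization L (Fin 2 → L) → GL (Fin 2) L)
    (hγ₀ : ∀ p, Projectivization.mk L ((γ₀ p : Matrix (Fin 2) (Fin 2) L) 1) (row_ne_zero (γ₀ p) 1) = p)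
    (hnorm : ∀ (w : Fin 2 → L) (hw : w ≠ 0), ∃ i : Fin 2, w i ≠ 0 ∧
      (γ₀ (Projectivization.mk L w hw) : Matrix (Fin 2) (Fin 2) L) 1 = (w i)⁻¹ • w ∧
      ∀ a b : Fin 2,
        (∃ k : Fin 2, (γ₀ (Projectivization.mk L w hw) : Matrix (Fin 2) (Fin 2) L) a b = 0 ∨
          (γ₀ (Projectivization.mk L w hw) : Matrix (Fin 2) (Fin 2) L) a b = 1 ∨
          (γ₀ (Projectivization.mk L w hw) : Matrix (Fin 2) (Fin 2) L) a b = (w i)⁻¹ * w k ∨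
          (γ₀ (Projectivization.mk L w hw) : Matrix (Fin 2) (Fin 2) L) a b = -((w i)⁻¹ * w k)) ∧
        (∃ k : Fin 2, (((γ₀ (Projectivization.mk L w hw))⁻¹ : GL (Fin 2) L) : Matrix (Fin 2) (Fin 2) L) a b = 0 ∨
          (((γ₀ (Projectivization.mk L w hw))⁻¹ : GL (Fin 2) L) : Matrix (Fin 2) (Fin 2) L) a b = 1 ∨
          (((γ₀ (Projectivization.mk L w hw))⁻¹ : GL (Fin 2) L) : Matrix (Fin 2) (Fin 2) L) a b = (w i)⁻¹ * w k ∨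
          (((γ₀ (Projectivization.mk L w hw))⁻¹ : GL (Fin 2) L) : Matrix (Fin 2) (Fin 2) L) a b = -((w i)⁻¹ * w k)))
    -- the archimedean frames of record BY VALUE (★ G7 ∕ ★ `K2LiuSiegelEisensteinKindWArchAdapter`)
    (hc : (IsCMField.complexConj L : L ≃ₐ[Fp L] L) ≠ 1)
    {Sinf : Type} [Fintype Sinf] (wp : Sinf → {v : InfinitePlace L // IsComplex v})
    (hwp : ∀ σ, (IsCMField.complexConj L : L ≃ₐ[Fp L] L) • (wp σ).1 = (wp σ).1)
    (hcover : ∀ v : InfinitePlace L, ∃ σ, (wp σ).1 = v)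
    (er : Fin 2 ⊕ Fin 2 ≃ Fin (2 + 2)) (T Tinv : Sinf → Matrix (Fin 2 ⊕ Fin 2) (Fin 2 ⊕ Fin 2) ℂ) (hT : ∀ σ, T σ * Tinv σ = 1) (hT' : ∀ σ, Tinv σ * T σ = 1)
    {M : ℝ} (hM : 1 ≤ M) (hTe : ∀ σ i j, ‖T σ i j‖ ≤ M) (hTe' : ∀ σ i j, ‖Tinv σ i j‖ ≤ M)
    -- THE BLOCK LETTER (the (dec-2) fine letter in block currency ON `h`)
    (hBL₁ : ∀ z : ℂ, 0 < z.re → ∃ (C a a₂ κ₁ κ₂ Ng r : ℝ) (N₀ : ℕ) (e₁ e₂ : ℂ → ℝ),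
      0 ≤ C ∧ 0 ≤ a ∧ 0 ≤ a₂ ∧ 0 ≤ Ng ∧ 0 < r ∧ (∀ s : ℂ, dist s z < r → |e₁ s| ≤ κ₁ ∧ |e₂ s| ≤ κ₂) ∧
      ∀ (S : skewMatrices ((IsCMField.complexConj L : L ≃ₐ[Fp L] L) : L →+* L) ((gramR L e dV hdV dW hdW).map (algebraMap (Fp L) L))) (u w : Fin 2 → L),
        (S : Matrix (Fin 2) (Fin 2) L) = Matrix.vecMulVec u w → u ≠ 0 → ∀ (hw : w ≠ 0) (S' : Matrix (Fin 2) (Fin 2) L),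
        (∀ v : HA L e dV hdV dW hdW, v ∈ unipDelta L e dV hdV dW hdW →
          unipDeltaChar L e dV hdV dW hdW (S : Matrix (Fin 2) (Fin 2) L) ((Λ₀ (Matrix.GeneralLinearGroup.map (algebraMap L (AdeleRing (𝓞 L) L)) (γ₀ (Projectivization.mk L w hw))))⁻¹ * v * Λ₀ (Matrix.GeneralLinearGroup.map (algebraMap L (AdeleRing (𝓞 L) L)) (γ₀ (Projectivization.mk L w hw)))) =
            unipDeltaChar L e dV hdV dW hdW S' v) →
        ∀ D : ℕ, 1 ≤ D → (∀ i j, IsIntegral ℤ ((D : L) * (S : Matrix (Fin 2) (Fin 2) L) i j)) →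
        ∀ (D₀ : Matrix (Fin 2) (Fin 2) L) (σf : L),
        (((γ₀ (Projectivization.mk L w hw) : GL (Fin 2) L) : Matrix (Fin 2) (Fin 2) L).map ((IsCMField.complexConj L : L ≃ₐ[Fp L] L) : L →+* L))ᵀ * (gramR L e dV hdV dW hdW).map (algebraMap (Fp L) L) * D₀ =
            (gramR L e dV hdV dW hdW).map (algebraMap (Fp L) L) →
        D₀ * (S : Matrix (Fin 2) (Fin 2) L) * ((γ₀ (Projectivization.mk L w hw) : GL (Fin 2) L) : Matrix (Fin 2) (Fin 2) L)⁻¹ = Matrix.single 1 1 σf →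
        ∀ s : ℂ, dist s z < r → ∀ (h : HA L e dV hdV dW hdW) (A b d : Sinf → Matrix (Fin 2) (Fin 2) ℂ) (κ κ' : Sinf → Matrix (Fin 2 ⊕ Fin 2) (Fin 2 ⊕ Fin 2) ℂ),
        (∀ σ, κ σ * κ' σ = 1) → (∀ σ, κ' σ * κ σ = 1) → (∀ σ i j, ‖κ σ i j‖ ≤ M) → (∀ σ i j, ‖κ' σ i j‖ ≤ M) →
        (∀ σ, T σ * Matrix.reindex er.symm er.symm
            ((((archAt (Fp L) L (IsCMField.complexConj L : L ≃ₐ[Fp L] L) (2 + 2) (hermD L e dV hdV dW hdW) (wp σ) (hwp σ) hc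
                (archPart (Fp L) L (IsCMField.complexConj L : L ≃ₐ[Fp L] L) (2 + 2) (hermD L e dV hdV dW hdW) h) :
                archLocal L (2 + 2) (hermD L e dV hdV dW hdW) (wp σ)) : GL (Fin (2 + 2)) ℂ) : Matrix (Fin (2 + 2)) (Fin (2 + 2)) ℂ)) * Tinv σ =
          Matrix.fromBlocks (A σ) (b σ) 0 (d σ) * κ σ) →
        ‖whittakerDelta L eB₀ dB₀ hdB₀ dW hdW (Measure.map nB₀ μ₀)
            ((Matrix.reindex (idxSplit e eA₀ eB₀) (idxSplit e eA₀ eB₀) S').toBlocks₂₂)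
            (fun y => f s (blkD L e eA₀ eB₀ dA₀ hdA₀ dB₀ hdB₀ dV hdV hVA₀ hVB₀ dW hdW (1, y) * (Λ₀ (Matrix.GeneralLinearGroup.map (algebraMap L (AdeleRing (𝓞 L) L)) (γ₀ (Projectivization.mk L w hw))) * h))) 1‖ ≤
          C * adelicHeightGL (2 + 2) L (h : GL (Fin (2 + 2)) (AdeleRing (𝓞 L) L)) ^ a * (D : ℝ) ^ a₂ *
            (1 + ‖(fun i j => NumberField.mixedEmbedding L ((S : Matrix (Fin 2) (Fin 2) L) i j))‖) ^ N₀ *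
            ∏ σ, ((∑ k, ‖(((γ₀ (Projectivization.mk L w hw) : GL (Fin 2) L) : Matrix (Fin 2) (Fin 2) L).map (wp σ).1.embedding * A σ) 1 k‖ ^ 2) ^ e₁ s * ‖(((γ₀ (Projectivization.mk L w hw) : GL (Fin 2) L) : Matrix (Fin 2) (Fin 2) L).map (wp σ).1.embedding * A σ).det‖ ^ e₂ s *
              ((1 + (wp σ).1 σf * (∑ k, ‖(((γ₀ (Projectivization.mk L w hw) : GL (Fin 2) L) : Matrix (Fin 2) (Fin 2) L).map (wp σ).1.embedding * A σ) 1 k‖ ^ 2)) ^ Ng * Real.exp (-(Real.pi * ((wp σ).1 σf * (∑ k, ‖(((γ₀ (Projectivization.mk L w hw) : GL (Fin 2) L) : Matrix (Fin 2) (Fin 2) L).map (wp σ).1.embedding * A σ) 1 k‖ ^ 2))))))) :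
    ∃ Nb : ℕ,
      ∀ z : ℂ, 0 < z.re → ∃ C a a₂ c a' r : ℝ, 0 ≤ C ∧ 0 ≤ a ∧ 0 ≤ a₂ ∧ 0 < c ∧ 0 ≤ a' ∧ 0 < r ∧
        ∀ (S : skewMatrices ((IsCMField.complexConj L : L ≃ₐ[Fp L] L) : L →+* L) ((gramR L e dV hdV dW hdW).map (algebraMap (Fp L) L))) (u w : Fin 2 → L),
          (S : Matrix (Fin 2) (Fin 2) L) = Matrix.vecMulVec u w → u ≠ 0 → ∀ (hw : w ≠ 0) (S' : Matrix (Fin 2) (Fin 2) L),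
          (∀ v : HA L e dV hdV dW hdW, v ∈ unipDelta L e dV hdV dW hdW →
            unipDeltaChar L e dV hdV dW hdW (S : Matrix (Fin 2) (Fin 2) L) ((Λ₀ (Matrix.GeneralLinearGroup.map (algebraMap L (AdeleRing (𝓞 L) L)) (γ₀ (Projectivization.mk L w hw))))⁻¹ * v * Λ₀ (Matrix.GeneralLinearGroup.map (algebraMap L (AdeleRing (𝓞 L) L)) (γ₀ (Projectivization.mk L w hw)))) =
              unipDeltaChar L e dV hdV dW hdW S' v) →
          ∀ D : ℕ, 1 ≤ D → (∀ i j, IsIntegral ℤ ((D : L) * (S : Matrix (Fin 2) (Fin 2) L) i j)) →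
          ∀ s : ℂ, dist s z < r → ∀ h : HA L e dV hdV dW hdW,
            ‖whittakerDelta L eB₀ dB₀ hdB₀ dW hdW (Measure.map nB₀ μ₀)
                ((Matrix.reindex (idxSplit e eA₀ eB₀) (idxSplit e eA₀ eB₀) S').toBlocks₂₂)
                (fun y => f s (blkD L e eA₀ eB₀ dA₀ hdA₀ dB₀ hdB₀ dV hdV hVA₀ hVB₀ dW hdW (1, y) * (Λ₀ (Matrix.GeneralLinearGroup.map (algebraMap L (AdeleRing (𝓞 L) L)) (γ₀ (Projectivization.mk L w hw))) * h))) 1‖ ≤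
              C * adelicHeightGL (2 + 2) L (h : GL (Fin (2 + 2)) (AdeleRing (𝓞 L) L)) ^ a * (D : ℝ) ^ a₂ *
                (Real.exp (-(c * adelicHeightGL (2 + 2) L (h : GL (Fin (2 + 2)) (AdeleRing (𝓞 L) L)) ^ (-a') * ‖(fun i j => NumberField.mixedEmbedding L ((S : Matrix (Fin 2) (Fin 2) L) i j))‖)) * (1 + ‖(fun i j => NumberField.mixedEmbedding L ((S : Matrix (Fin 2) (Fin 2) L) i j))‖) ^ Nb) := by
  classical
  letI : MeasurableSpace (unipDelta L e dV hdV dW hdW) := borel _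
  haveI : BorelSpace (unipDelta L e dV hdV dW hdW) := ⟨rfl⟩
  -- constants independent of `z`: height floor `c₀`, mover constant `cB′ = c_B + c₀⁻¹` (`1 ≤ cB′·H`), Gaussian constant `cg` of ★ (ρ4-𝔸) at `C_B := cB′`
  obtain ⟨c₀, hc₀, hfloor⟩ := exists_adelicHeightGL_floor L (2 + 2)
  have hM0 : 0 ≤ M := zero_le_one.trans hM
  obtain ⟨cB', hcB'⟩ : ∃ cB' : ℝ, cB' = (Fintype.card (Fin 2 ⊕ Fin 2) : ℝ) ^ 3 * M ^ 3 + c₀⁻¹ := ⟨_, rfl⟩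
  have hcBle : (Fintype.card (Fin 2 ⊕ Fin 2) : ℝ) ^ 3 * M ^ 3 ≤ cB' := by
    rw [hcB']; exact le_add_of_nonneg_right (inv_nonneg.2 hc₀.le)
  have hcB'inv : c₀⁻¹ ≤ cB' := by
    rw [hcB']; exact le_add_of_nonneg_left (by positivity)
  have hcB'pos : 0 < cB' := lt_of_lt_of_le (inv_pos.2 hc₀) hcB'inv
  obtain ⟨cg, hcg, hgauss⟩ := K2LiuKindOneLineCornerGramBoundAdelic.exists_exp_neg_sum_le_exp_neg_height_of_cover L e dV hdV dW hdW hdV0 hdW0 (1 : Fin 2) hcB'pos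
  refine ⟨0, fun z hz => ?_⟩
  obtain ⟨C, a, a₂, κ₁, κ₂, Ng, r, N₀, e₁, e₂, hC, ha, ha₂, hNg, hr, hexp, hB⟩ := hBL₁ z hz
  -- integer ceilings of the payer's exponents and the derived constants
  obtain ⟨k, hk⟩ : ∃ k : ℕ, k = ⌈κ₁⌉₊ + ⌈κ₂⌉₊ := ⟨_, rfl⟩
  obtain ⟨nS, hnS⟩ : ∃ nS : ℕ, nS = Fintype.card Sinf := ⟨_, rfl⟩
  obtain ⟨dL, hdL⟩ : ∃ dL : ℕ, dL = Module.finrank ℚ L := ⟨_, rfl⟩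
  obtain ⟨Mτ, hMτ⟩ : ∃ Mτ : ℕ, Mτ = N₀ + 2 * (dL + 1) * k * nS := ⟨_, rfl⟩
  obtain ⟨K, hK⟩ : ∃ K : ℝ, K = (2 : ℝ) ^ ⌈Ng⌉₊ * (1 + ((⌈Ng⌉₊).factorial : ℝ) * (2 / Real.pi) ^ ⌈Ng⌉₊) := ⟨_, rfl⟩
  have hK0 : 0 ≤ K := by rw [hK]; positivity
  obtain ⟨P0, hP0⟩ : ∃ P0 : ℝ, P0 = 8 * cB' ^ 2 := ⟨_, rfl⟩
  have hP00 : 0 ≤ P0 := by rw [hP0]; positivity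
  obtain ⟨Kabs, hKabs⟩ : ∃ Kabs : ℝ,
      Kabs = (2 : ℝ) ^ Mτ * (c₀ ^ (-((2 : ℝ) * Mτ)) + (Mτ.factorial : ℝ) * (2 / (cg / 2)) ^ Mτ) := ⟨_, rfl⟩
  have hKabs0 : 0 ≤ Kabs := by
    rw [hKabs]
    exact mul_nonneg (pow_nonneg zero_le_two _) (add_nonneg (Real.rpow_nonneg hc₀.le _) (by positivity))
  refine ⟨C * (P0 ^ k * K) ^ nS * Kabs, a + ((2 * k * nS : ℕ) : ℝ) + 2 * (Mτ : ℝ), a₂ + ((2 * (dL + 1) * k * nS : ℕ) : ℝ), cg / 2 / 2, 2, r,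
    mul_nonneg (mul_nonneg hC (pow_nonneg (mul_nonneg (pow_nonneg hP00 _) hK0) _)) hKabs0, by positivity, by positivity, by positivity,
    by norm_num, hr, fun S u w_ hS1 hu hw S' hψ D hD hint s hs h => ?_⟩
  obtain ⟨Hh, hHh⟩ : ∃ Hh : ℝ, adelicHeightGL (2 + 2) L (h : GL (Fin (2 + 2)) (AdeleRing (𝓞 L) L)) = Hh := ⟨_, rfl⟩
  obtain ⟨τ, hτ⟩ : ∃ τ : ℝ, ‖(fun i j => NumberField.mixedEmbedding L ((S : Matrix (Fin 2) (Fin 2) L) i j))‖ = τ := ⟨_, rfl⟩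
  rw [hHh, hτ]
  have hH : c₀ ≤ Hh := hHh ▸ hfloor _
  have hH0 : 0 < Hh := lt_of_lt_of_le hc₀ hH
  have hτ0 : 0 ≤ τ := hτ ▸ norm_nonneg _
  have hD1 : (1 : ℝ) ≤ D := by exact_mod_cast hD
  have hD0 : (0 : ℝ) < D := by linarith
  have hM1 : 1 ≤ cB' * Hh := by
    calc (1 : ℝ) = c₀⁻¹ * c₀ := (inv_mul_cancel₀ hc₀.ne').symm
      _ ≤ cB' * Hh := mul_le_mul hcB'inv hH hc₀.le hcB'pos.le
  have hκ : |e₁ s| ≤ (⌈κ₁⌉₊ : ℝ) ∧ |e₂ s| ≤ (⌈κ₂⌉₊ : ℝ) :=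
    ⟨((hexp s hs).1).trans (Nat.le_ceil _), ((hexp s hs).2).trans (Nat.le_ceil _)⟩
  -- (1) the rational letters `D₀, σ♭` of the normalised row section `ĝ = γ₀[w]` (★ p862643)
  have hlevi := exists_rat_levi_blocks_levi_map Λ₀ hΛ₀ hdV0 hdW0 (γ₀ (Projectivization.mk L w_ hw))
  obtain ⟨-, D₀, hd, hrel, hD₀⟩ := hlevi
  have hci := conj_index_eq_single Λ₀ hΛ₀ hdV0 hdW0 S.2 hS1 hu hw γ₀ hγ₀ hd hD₀
  obtain ⟨hsingle, -⟩ := hci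
  obtain ⟨σf, hσf⟩ : ∃ σf : L, (D₀ * (S : Matrix (Fin 2) (Fin 2) L) *
      ((γ₀ (Projectivization.mk L w_ hw) : GL (Fin 2) L) : Matrix (Fin 2) (Fin 2) L)⁻¹) 1 1 = σf := ⟨_, rfl⟩
  rw [hσf] at hsingle
  -- (2) the block decomposition of `h_∞` in the frames of record (★ p862843) and its entry bounds (★ G7-B)
  have hbd := exists_blockDecomposition_archAt (Fp L) L (IsCMField.complexConj L : L ≃ₐ[Fp L] L) (2 + 2) (hermD L e dV hdV dW hdW)
    hc wp hwp er T Tinv hT hM h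
  obtain ⟨A, bb, dd, κm, κm', hκm, hκm', hκme, hκme', hdec⟩ := hbd
  have hblk : ∀ σ, (∀ i j, ‖A σ i j‖ ≤ cB' * Hh) ∧ (∀ i j, ‖(A σ)⁻¹ i j‖ ≤ cB' * Hh) ∧ A σ * (A σ)⁻¹ = 1 := by
    intro σ
    have hb := blockData_of_decomp (Fp L) L (IsCMField.complexConj L : L ≃ₐ[Fp L] L) (2 + 2) (hermD L e dV hdV dW hdW) hc wp hwp er T Tinv hT hT'
      hM hTe hTe' h A bb dd κm κm' hκm hκm' hκme hκme' hdec σ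
    rw [adelicVal_apply, hHh] at hb
    have hle : (Fintype.card (Fin 2 ⊕ Fin 2) : ℝ) ^ 3 * M ^ 3 * Hh ≤ cB' * Hh := mul_le_mul_of_nonneg_right hcBle hH0.le
    exact ⟨fun i j => (hb.1 i j).trans hle, fun i j => (hb.2.1 i j).trans hle, hb.2.2⟩
  have hmain := hB S u w_ hS1 hu hw S' hψ D hD hint D₀ σf hrel hsingle s hs h A bb dd κm κm' hκm hκm' hκme hκme' hdec
  rw [hHh, hτ] at hmain
  -- (4) the entry bound `Vb = 1 + τ·D^{d+1}(1+τ)^d` of `ĝ^φ`, `(ĝ⁻¹)^φ` and the unit entry of the normalised row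
  obtain ⟨i, hwi, hrow, hent⟩ := hnorm w_ hw
  obtain ⟨j, huj⟩ : ∃ j, u j ≠ 0 := Function.ne_iff.1 hu
  obtain ⟨B, hBdef⟩ : ∃ B : ℝ, B = τ * ((D : ℝ) ^ (dL + 1) * (1 + τ) ^ dL) := ⟨_, rfl⟩
  have hB0 : 0 ≤ B := by rw [hBdef]; positivity
  have hratio : ∀ (σ : Sinf) (k' : Fin 2), ‖(wp σ).1.embedding ((w_ i)⁻¹ * w_ k')‖ ≤ B := fun σ k' => by
    have h1 := norm_embedding_ratio_le (wp σ).1 hS1 huj hwi hD hint k'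
    rwa [hτ, ← hdL, ← hBdef] at h1
  have hGe : ∀ (σ : Sinf) (a' b' : Fin 2),
      ‖(((γ₀ (Projectivization.mk L w_ hw) : GL (Fin 2) L) : Matrix (Fin 2) (Fin 2) L).map (wp σ).1.embedding) a' b'‖ ≤ 1 + B :=
    fun σ a' b' => by
      rw [Matrix.map_apply]
      obtain ⟨⟨k', hk'⟩, -⟩ := hent a' b'
      exact norm_embedding_le_one_add_of_cases (wp σ).1 hB0 (hratio σ k') hk'
  have hGie : ∀ (σ : Sinf) (a' b' : Fin 2),
      ‖((((γ₀ (Projectivization.mk L w_ hw))⁻¹ : GL (Fin 2) L) : Matrix (Fin 2) (Fin 2) L).map (wp σ).1.embedding) a' b'‖ ≤ 1 + B :=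
    fun σ a' b' => by
      rw [Matrix.map_apply]
      obtain ⟨-, ⟨k', hk'⟩⟩ := hent a' b'
      exact norm_embedding_le_one_add_of_cases (wp σ).1 hB0 (hratio σ k') hk'
  have hGG : ∀ σ : Sinf, ((γ₀ (Projectivization.mk L w_ hw) : GL (Fin 2) L) : Matrix (Fin 2) (Fin 2) L).map (wp σ).1.embedding *
      (((γ₀ (Projectivization.mk L w_ hw))⁻¹ : GL (Fin 2) L) : Matrix (Fin 2) (Fin 2) L).map (wp σ).1.embedding = 1 := fun σ => by
    rw [← Matrix.map_mul, Units.mul_inv, Matrix.map_one _ (map_zero _) (map_one _)]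
  have hunit : ∀ σ : Sinf, ‖(((γ₀ (Projectivization.mk L w_ hw) : GL (Fin 2) L) : Matrix (Fin 2) (Fin 2) L).map (wp σ).1.embedding) 1 i‖ = 1 :=
    fun σ => by
      rw [Matrix.map_apply]
      exact norm_map_row_apply_eq_one (wp σ).1.embedding hwi hrow
  have hVb1 : 1 ≤ 1 + B := le_add_of_nonneg_right hB0
  -- the ceiling `a₁ := P0 · V`, `V := H²·(D^{d+1}(1+τ)^{d+1})²`
  obtain ⟨V, hV⟩ : ∃ V : ℝ, V = Hh ^ 2 * ((D : ℝ) ^ (dL + 1) * (1 + τ) ^ (dL + 1)) ^ 2 := ⟨_, rfl⟩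
  have hV0 : 0 ≤ V := by rw [hV]; positivity
  have ha₁ : 8 * (1 + B) ^ 2 * (cB' * Hh) ^ 2 ≤ P0 * V := by
    have hW0 : 1 + B ≤ (D : ℝ) ^ (dL + 1) * (1 + τ) ^ (dL + 1) := by rw [hBdef]; exact one_add_mul_le_pow_mul_pow hD1 hτ0 dL
    have hB1 : 0 ≤ 1 + B := by linarith
    calc 8 * (1 + B) ^ 2 * (cB' * Hh) ^ 2 ≤ 8 * ((D : ℝ) ^ (dL + 1) * (1 + τ) ^ (dL + 1)) ^ 2 * (cB' * Hh) ^ 2 := by gcongr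
      _ = P0 * V := by rw [hP0, hV]; ring
  -- (5) the per-place factor (★ `perPlace_le`), exponents rounded up to integers (`a₁ ≥ 1`)
  have hρ0 : ∀ σ : Sinf, 0 ≤ ∑ k', ‖(((γ₀ (Projectivization.mk L w_ hw) : GL (Fin 2) L) : Matrix (Fin 2) (Fin 2) L).map (wp σ).1.embedding * A σ) 1 k'‖ ^ 2 :=
    fun σ => Finset.sum_nonneg fun _ _ => sq_nonneg _
  have hper : ∀ σ : Sinf,
      (∑ k', ‖(((γ₀ (Projectivization.mk L w_ hw) : GL (Fin 2) L) : Matrix (Fin 2) (Fin 2) L).map (wp σ).1.embedding * A σ) 1 k'‖ ^ 2) ^ e₁ s *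
          ‖(((γ₀ (Projectivization.mk L w_ hw) : GL (Fin 2) L) : Matrix (Fin 2) (Fin 2) L).map (wp σ).1.embedding * A σ).det‖ ^ e₂ s *
        ((1 + (wp σ).1 σf * (∑ k', ‖(((γ₀ (Projectivization.mk L w_ hw) : GL (Fin 2) L) : Matrix (Fin 2) (Fin 2) L).map (wp σ).1.embedding * A σ) 1 k'‖ ^ 2)) ^ Ng *
          Real.exp (-(Real.pi * ((wp σ).1 σf * (∑ k', ‖(((γ₀ (Projectivization.mk L w_ hw) : GL (Fin 2) L) : Matrix (Fin 2) (Fin 2) L).map (wp σ).1.embedding * A σ) 1 k'‖ ^ 2))))) ≤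
      (P0 ^ k * V ^ k * K) *
        Real.exp (-(Real.pi / 2 * ((wp σ).1 σf * (∑ k', ‖(((γ₀ (Projectivization.mk L w_ hw) : GL (Fin 2) L) : Matrix (Fin 2) (Fin 2) L).map (wp σ).1.embedding * A σ) 1 k'‖ ^ 2)))) := by
    intro σ
    have hp := K2LiuKindOneLineDecayOneFramePrelims.perPlace_le (hGG σ) (hblk σ).2.2 hVb1 (hGe σ) (hGie σ) (hblk σ).1 (hblk σ).2.1 (hunit σ)
      ha₁ hκ.1 hκ.2 (apply_nonneg (wp σ).1 σf) Ng
    refine hp.trans (le_of_eq ?_)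
    have hQ1 : (P0 * V) ^ ((⌈κ₁⌉₊ : ℕ) : ℝ) * (P0 * V) ^ ((⌈κ₂⌉₊ : ℕ) : ℝ) = P0 ^ k * V ^ k := by
      rw [Real.rpow_natCast, Real.rpow_natCast, ← pow_add, ← hk, mul_pow]
    rw [hQ1, ← hK]
    ring
  have hF0 : ∀ σ : Sinf, 0 ≤
      (∑ k', ‖(((γ₀ (Projectivization.mk L w_ hw) : GL (Fin 2) L) : Matrix (Fin 2) (Fin 2) L).map (wp σ).1.embedding * A σ) 1 k'‖ ^ 2) ^ e₁ s *
          ‖(((γ₀ (Projectivization.mk L w_ hw) : GL (Fin 2) L) : Matrix (Fin 2) (Fin 2) L).map (wp σ).1.embedding * A σ).det‖ ^ e₂ s *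
        ((1 + (wp σ).1 σf * (∑ k', ‖(((γ₀ (Projectivization.mk L w_ hw) : GL (Fin 2) L) : Matrix (Fin 2) (Fin 2) L).map (wp σ).1.embedding * A σ) 1 k'‖ ^ 2)) ^ Ng *
          Real.exp (-(Real.pi * ((wp σ).1 σf * (∑ k', ‖(((γ₀ (Projectivization.mk L w_ hw) : GL (Fin 2) L) : Matrix (Fin 2) (Fin 2) L).map (wp σ).1.embedding * A σ) 1 k'‖ ^ 2))))) :=
    fun σ => mul_nonneg (mul_nonneg (Real.rpow_nonneg (hρ0 σ) _) (Real.rpow_nonneg (norm_nonneg _) _))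
      (mul_nonneg (Real.rpow_nonneg (add_nonneg zero_le_one (mul_nonneg (apply_nonneg _ _) (hρ0 σ))) _) (Real.exp_pos _).le)
  have hprod := Finset.prod_le_prod (fun σ _ => hF0 σ) (fun σ _ => hper σ) (s := Finset.univ)
  -- the product of the per-place bounds: a constant power times ONE Gaussian in the place sum
  have hprod2 : ∏ σ : Sinf, (P0 ^ k * V ^ k * K) *
        Real.exp (-(Real.pi / 2 * ((wp σ).1 σf * (∑ k', ‖(((γ₀ (Projectivization.mk L w_ hw) : GL (Fin 2) L) : Matrix (Fin 2) (Fin 2) L).map (wp σ).1.embedding * A σ) 1 k'‖ ^ 2)))) =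
      (P0 ^ k * V ^ k * K) ^ nS * Real.exp (-(Real.pi / 2 * ∑ σ : Sinf, (wp σ).1 σf *
        (∑ k', ‖(((γ₀ (Projectivization.mk L w_ hw) : GL (Fin 2) L) : Matrix (Fin 2) (Fin 2) L).map (wp σ).1.embedding * A σ) 1 k'‖ ^ 2))) := by
    rw [Finset.prod_mul_distrib, Finset.prod_const, Finset.card_univ, ← hnS, ← Real.exp_sum, Finset.mul_sum, ← Finset.sum_neg_distrib]
  -- (6) the Gaussian against the height (★ (ρ4-𝔸), cover-indexed; the letter holds with EQUALITY by ★ `corner_row_sq_eq`)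
  have hga := hgauss (fun σ : Sinf => (wp σ).1) hcover (γ₀ (Projectivization.mk L w_ hw)) D₀ hrel (S : Matrix (Fin 2) (Fin 2) L) σf hsingle
    A (fun σ => (A σ)⁻¹) (fun σ => (hblk σ).2.2) (M := cB' * Hh) (fun σ k' l => (hblk σ).2.1 k' l)
    (fun σ => Real.sqrt (∑ k', ‖(((γ₀ (Projectivization.mk L w_ hw) : GL (Fin 2) L) : Matrix (Fin 2) (Fin 2) L).map (wp σ).1.embedding * A σ) 1 k'‖ ^ 2))
    (fun σ => by
      rw [Real.sq_sqrt (hρ0 σ), K2LiuKindOneLineCornerBlockFaces.corner_row_sq_eq]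
      rfl)
    hH0 hM1 le_rfl
  have hsum_eq : ∑ σ : Sinf, (wp σ).1 σf *
        Real.sqrt (∑ k', ‖(((γ₀ (Projectivization.mk L w_ hw) : GL (Fin 2) L) : Matrix (Fin 2) (Fin 2) L).map (wp σ).1.embedding * A σ) 1 k'‖ ^ 2) ^ 2 =
      ∑ σ : Sinf, (wp σ).1 σf * (∑ k', ‖(((γ₀ (Projectivization.mk L w_ hw) : GL (Fin 2) L) : Matrix (Fin 2) (Fin 2) L).map (wp σ).1.embedding * A σ) 1 k'‖ ^ 2) :=
    Finset.sum_congr rfl fun σ _ => by rw [Real.sq_sqrt (hρ0 σ)]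
  rw [hsum_eq, hτ] at hga
  have hexp2 : Real.exp (-(Real.pi / 2 * ∑ σ : Sinf, (wp σ).1 σf *
        (∑ k', ‖(((γ₀ (Projectivization.mk L w_ hw) : GL (Fin 2) L) : Matrix (Fin 2) (Fin 2) L).map (wp σ).1.embedding * A σ) 1 k'‖ ^ 2))) ≤
      Real.exp (-(cg / 2 * Hh ^ (-(2 : ℝ)) * τ)) := by
    have h1 := Real.exp_le_exp.1 hga
    exact Real.exp_le_exp.2 (by linarith)
  -- (7) absorption of every `(1 + τ)`-power into the Gaussian (★ `one_add_pow_mul_exp_neg_le`, `a′ = 2`)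
  have habs := one_add_pow_mul_exp_neg_le (c := cg / 2) (c₀ := c₀) (H := Hh) (a' := 2) (τ := τ) (half_pos hcg) hc₀ hH (by norm_num) hτ0 Mτ
  rw [← hKabs] at habs
  have hE0 : 0 ≤ Real.exp (-(cg / 2 * Hh ^ (-(2 : ℝ)) * τ)) := (Real.exp_pos _).le
  calc ‖whittakerDelta L eB₀ dB₀ hdB₀ dW hdW (Measure.map nB₀ μ₀)
            ((Matrix.reindex (idxSplit e eA₀ eB₀) (idxSplit e eA₀ eB₀) S').toBlocks₂₂)
            (fun y => f s (blkD L e eA₀ eB₀ dA₀ hdA₀ dB₀ hdB₀ dV hdV hVA₀ hVB₀ dW hdW (1, y) *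
              (Λ₀ (Matrix.GeneralLinearGroup.map (algebraMap L (AdeleRing (𝓞 L) L)) (γ₀ (Projectivization.mk L w_ hw))) * h))) 1‖
      ≤ C * Hh ^ a * (D : ℝ) ^ a₂ * (1 + τ) ^ N₀ *
          ∏ σ : Sinf, (∑ k', ‖(((γ₀ (Projectivization.mk L w_ hw) : GL (Fin 2) L) : Matrix (Fin 2) (Fin 2) L).map (wp σ).1.embedding * A σ) 1 k'‖ ^ 2) ^ e₁ s *
              ‖(((γ₀ (Projectivization.mk L w_ hw) : GL (Fin 2) L) : Matrix (Fin 2) (Fin 2) L).map (wp σ).1.embedding * A σ).det‖ ^ e₂ s *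
            ((1 + (wp σ).1 σf * (∑ k', ‖(((γ₀ (Projectivization.mk L w_ hw) : GL (Fin 2) L) : Matrix (Fin 2) (Fin 2) L).map (wp σ).1.embedding * A σ) 1 k'‖ ^ 2)) ^ Ng *
              Real.exp (-(Real.pi * ((wp σ).1 σf * (∑ k', ‖(((γ₀ (Projectivization.mk L w_ hw) : GL (Fin 2) L) : Matrix (Fin 2) (Fin 2) L).map (wp σ).1.embedding * A σ) 1 k'‖ ^ 2))))) := hmain
    _ ≤ C * Hh ^ a * (D : ℝ) ^ a₂ * (1 + τ) ^ N₀ * ((P0 ^ k * V ^ k * K) ^ nS * Real.exp (-(cg / 2 * Hh ^ (-(2 : ℝ)) * τ))) := by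
        refine mul_le_mul_of_nonneg_left (hprod.trans ?_) (by positivity)
        rw [hprod2]
        exact mul_le_mul_of_nonneg_left hexp2 (by positivity)
    _ = C * (P0 ^ k * K) ^ nS * (Hh ^ a * Hh ^ (2 * k * nS)) * ((D : ℝ) ^ a₂ * (D : ℝ) ^ (2 * (dL + 1) * k * nS)) *
          (Real.exp (-(cg / 2 * Hh ^ (-(2 : ℝ)) * τ)) * (1 + τ) ^ Mτ) := by
        rw [hV, hMτ]
        generalize 1 + τ = t
        ring
    _ ≤ C * (P0 ^ k * K) ^ nS * (Hh ^ a * Hh ^ (2 * k * nS)) * ((D : ℝ) ^ a₂ * (D : ℝ) ^ (2 * (dL + 1) * k * nS)) *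
          (Kabs * Hh ^ ((2 : ℝ) * Mτ) * Real.exp (-(cg / 2 / 2 * Hh ^ (-(2 : ℝ)) * τ))) :=
        mul_le_mul_of_nonneg_left habs (by positivity)
    _ = C * (P0 ^ k * K) ^ nS * Kabs * Hh ^ (a + ((2 * k * nS : ℕ) : ℝ) + 2 * (Mτ : ℝ)) * (D : ℝ) ^ (a₂ + ((2 * (dL + 1) * k * nS : ℕ) : ℝ)) *
          (Real.exp (-(cg / 2 / 2 * Hh ^ (-(2 : ℝ)) * τ)) * (1 + τ) ^ 0) := by
        rw [Real.rpow_add hH0, Real.rpow_add hH0, Real.rpow_natCast, Real.rpow_add hD0, Real.rpow_natCast, pow_zero, mul_one]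
        ring

end Summit.HodgeConjecture.HodgeConjecture.Cruxes.HLiu418.K2LiuKindOneLineDecayOneFrame

end
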